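import Summits.AnomalousDissipation.AnomalousDissipation.Theses.PumpedMirror
import Summits.AnomalousDissipation.AnomalousDissipation.Theorems.TaylorGreenLogLoudStates.Negative.Eigenforce
import Summits.AnomalousDissipation.AnomalousDissipation.Theorems.TaylorCertificatesFloorCertificateStubEigenforceWorkBound
import Literature.Analysis.FluidPDE.StatisticalSolutionEnergyEq
import Summits.AnomalousDissipation.AnomalousDissipation.Theorems.GPStatisticalRigidity.Negative.IntegrableRedundant

/-!
# `PumpedMirror.MirrorFloorTG` (stmt-AnomalousDissipation-15372) AT SMALL ENERGY — settled, with an explicit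
# ν-independent certificate; anti-pumping; the `O(ν)` free floor; emptiness of the low-energy relaxed class

Line `registered` (lead `prover-line-stmt-AnomalousDissipation-15372-c1-0`); statements and proofs adapted from the
crux strategist's typed census `Cruxes/MirrorFloorTG/StrategistCensusS1.lean` §0, §B–§E
(planner-cstrat-stmt-AnomalousDissipation-15372-s1-0, 2026-08-17), restated over tree vocabulary.

* `mirrorFloorTG_smallEnergy` — THE CRUX VERBATIM with the one extra hypothesis `E ≤ E₁`: TRUE, by an explicit,
  ν-INDEPENDENT certificate (`Φ₁` = the work functional, `Φ₁'(u) = f_TG` on the ball; `θ₁ = 0`; `ε₀ = 1/8`;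
  `E₁ = 1/(16(C_TG+1))`, `C_TG = sup_x Σᵢ‖∂ᵢf_TG(x)‖`). The floor Lagrangian at the work functional reads
  `ν‖∇u‖² + ¼ − 12π²ν(u,f_TG) + I_{f_TG}(u)` with `|I_{f_TG}(u)| ≤ C_TG|u|²`, `|(u,f_TG)| ≤ ½|u|`.
* `antiPumping_tg` — every relaxed statistic of `NS_ν(f_TG)` (no symmetry, no energy inequality) has
  `¼ + ∫I_{f_TG}dμ ≤ ½(12π²ν ε(μ))^{1/2}` (instance of the landed `stub_eigenforceWorkBound`, `λ = 12π²`,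
  `‖f_TG‖² = ¼`): statistics of bounded dissipation cancel the force by Reynolds stress.
* `fixedViscosity_floor` — THE FREE FLOOR IS `O(ν)`: `∃ c > 0 ∀ ν ≤ 1/64`, every relaxed statistic of `NS_ν(f_TG)`
  on any ball dissipates `≥ cν`. The crux is exactly the upgrade `cν ↦ ε₀(E)`.
* `relaxed_empty_smallEnergy`, `mirrorLawsLoudTG_smallEnergy` — the relaxed K-class is EMPTY for `E ≤ E₁` and
  `ν ≤ 1/64`, so the line's open stub S3 (`stub_mirrorLawsLoudTG`) holds below `E₁` vacuously; every refutation
  of the crux must therefore live at a level `E > E₁` along a family `ν_j → 0`.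

References: Foias–Manley–Rosa–Temam 2001, Ch. IV §1.2; Marchioro, Comm. Math. Phys. 105 (1986) 99–106;
Tobasco–Goluskin–Doering, Phys. Lett. A 382 (2018); Brachet et al., J. Fluid Mech. 130 (1983) §2.
-/

noncomputable section

set_option linter.dupNamespace false

namespace Summit.AnomalousDissipation.AnomalousDissipation.Theorems.PumpedMirrorMirrorFloorTG

open MeasureTheory Filter Topology UnitAddTorus
open scoped InnerProductSpace RealInnerProductSpace ENNReal NNReal
open Literature.Analysis.FunctionSpaces Literature.Analysis.FunctionSpaces.Torus Literature.Analysis.FluidPDE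
open Summit.AnomalousDissipation.AnomalousDissipation.Theses.PumpedMirror
open Summit.AnomalousDissipation.AnomalousDissipation.Theorems.TaylorGreenLoudGalerkinStates.Negative
  (tgForce tgShell tgCoeff tgForce_eq_realTrigPoly isSmooth_tgForce isDivFree_tgForce hasZeroMean_tgForce
    integral_norm_sq_tgForce continuous_tgForce)
open Summit.AnomalousDissipation.AnomalousDissipation.Theorems.TaylorGreenLogLoudStates.Negative
  (laplacian_tgForce_eq)
open Summit.AnomalousDissipation.AnomalousDissipation.Theorems.TaylorCertificatesFloorCertificate
  (eigenforce_exists_workTest eigenforce_nsGeneratorPairing_self stub_eigenforceWorkBound)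
open Summit.AnomalousDissipation.AnomalousDissipation.Theorems.GPStatisticalRigidity.Negative
  (integrable_norm_sq_of_ensembleEnstrophy_lt_top)

/-! ## §0 `f_TG` is a Stokes eigenfield, pointwise: `Δ f_TG = −12π² f_TG` -/

/-- `Δ f_TG(x) = −12π² f_TG(x)` for every `x` (the TG shell is `|k|² = 3`). [folklore] -/
theorem laplacian_tgForce_apply (x : UnitAddTorus (Fin 3)) :
    Torus.laplacian tgForce x = (-(12 * Real.pi ^ 2)) • tgForce x := by
  rw [laplacian_tgForce_eq]
  conv_rhs => rw [tgForce_eq_realTrigPoly]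
  have h : ((-(12 * Real.pi ^ 2) : ℝ) • tgCoeff) = ((-(12 * Real.pi ^ 2) : ℝ) : ℂ) • tgCoeff := by
    funext k; rw [Pi.smul_apply, Pi.smul_apply, Complex.coe_smul]
  rw [realTrigPoly_apply, realTrigPoly_apply, h, trigPoly_smul, Pi.smul_apply, Complex.coe_smul, map_smul]

/-- **The Reynolds stress against `f_TG` is bounded by the energy**: `|I_{f_TG}(u)| ≤ C_TG |u|²` for all
`u ∈ L²`, with `C_TG = sup_x Σᵢ ‖∂ᵢ f_TG(x)‖`. [folklore] -/
theorem exists_abs_inertialPairing_tg_le :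
    ∃ C : ℝ, 0 ≤ C ∧ ∀ u : Torus.energySpace (Fin 3), |Torus.inertialPairing u.1 tgForce| ≤ C * ‖u‖ ^ 2 := by
  obtain ⟨C, hC0, hC⟩ := Torus.exists_sum_norm_partialDeriv_le isSmooth_tgForce
  refine ⟨C, hC0, fun u => ?_⟩
  have h := (Torus.integrable_inner_fderiv_apply_coe isSmooth_tgForce hC u.1 u.1).2
  rw [Torus.inertialPairing]
  refine h.trans (le_of_eq ?_)
  rw [Submodule.coe_norm, sq]

/-! ## §B SMALL ENERGY: the crux holds with a ν-INDEPENDENT, EXPLICIT certificate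

The floor Lagrangian at the WORK FUNCTIONAL `Φ_W` (`Φ_W'(u) = f_TG` on the ball, one coordinate) and
weight `θ = 0` reads `ν‖∇u‖² + ⟨F_ν(u), f_TG⟩ = ν‖∇u‖² + ¼ − 12π²ν (u, f_TG) + I_{f_TG}(u)`, and
`|I_{f_TG}(u)| ≤ C_TG |u|²`, `|(u,f_TG)| ≤ ½|u|`. Hence for `E ≤ E₁ := 1/(16 (C_TG + 1))` and
`ν < ν₀(E)` the floor `⅛` holds at EVERY state of the ball `|u|² ≤ E` — symmetric or not, finite
enstrophy or not — with ONE certificate chosen before `ν`. Census heading STRENGTHEN: the ν-uniform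
strengthening, refuted on the Leray ball for every force (`FloorCertificate/Negative/Uniform.lean`), is
TRUE on low-energy slabs; census heading DECOMPOSITION: the `E`-axis splits into a settled compact
piece and the crux. -/

/-- **Uniform small-energy floor.** There is `E₁ > 0` such that for every `0 < E ≤ E₁` ONE cylindrical
test functional `Φ` (the work functional on the ball `|u|² ≤ E`) certifies, for every
`0 < ν < ν₀(E)`, the floor `⅛ ≤ ν‖∇u‖² + ⟨F_ν(u), Φ'(u)⟩` at every `u ∈ H` with `|u|² ≤ E`. -/
theorem floor_smallEnergy_uniform :
    ∃ E₁ : ℝ, 0 < E₁ ∧ ∀ E : ℝ, 0 < E → E ≤ E₁ →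
      ∃ (Φ : Torus.CylindricalTest (Fin 3)) (ν₀ : ℝ), 0 < ν₀ ∧
        (∀ u : Torus.energySpace (Fin 3), ‖u‖ ^ 2 ≤ E → Φ.grad u = tgForce) ∧
        ∀ ν : ℝ, 0 < ν → ν < ν₀ → ∀ u : Torus.energySpace (Fin 3), ‖u‖ ^ 2 ≤ E →
          8⁻¹ ≤ ν * (Torus.eGradNormSq (u.1 : UnitAddTorus (Fin 3) → EuclideanSpace ℝ (Fin 3))).toReal +
            Torus.nsGeneratorPairing ν tgForce u (Φ.grad u) := by
  obtain ⟨C, hC0, hC⟩ := exists_abs_inertialPairing_tg_le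
  refine ⟨1 / (16 * (C + 1)), by positivity, fun E hE hE1 => ?_⟩
  obtain ⟨Φ, hΦ⟩ := eigenforce_exists_workTest E isSmooth_tgForce isDivFree_tgForce hasZeroMean_tgForce
  set M : ℝ := ‖(isSmooth_tgForce.memLp 2).toLp tgForce‖ with hM
  have hM0 : 0 ≤ M := norm_nonneg _
  refine ⟨Φ, 1 / (16 * (12 * Real.pi ^ 2) * (Real.sqrt E * M + 1)), by positivity, hΦ, ?_⟩
  intro ν hν hνlt u hu
  rw [hΦ u hu, eigenforce_nsGeneratorPairing_self ν (12 * Real.pi ^ 2) laplacian_tgForce_apply u, integral_norm_sq_tgForce]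
  -- the three error terms
  have hD : 0 ≤ ν * (Torus.eGradNormSq (u.1 : UnitAddTorus (Fin 3) → EuclideanSpace ℝ (Fin 3))).toReal := by positivity
  have hI : |Torus.inertialPairing u.1 tgForce| ≤ 16⁻¹ := by
    refine (hC u).trans ?_
    have hu' : ‖u‖ ^ 2 ≤ 1 / (16 * (C + 1)) := hu.trans hE1
    calc C * ‖u‖ ^ 2 ≤ (C + 1) * ‖u‖ ^ 2 := by nlinarith [sq_nonneg ‖u‖]
      _ ≤ (C + 1) * (1 / (16 * (C + 1))) := mul_le_mul_of_nonneg_left hu' (by positivity)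
      _ = 16⁻¹ := by field_simp
  have hP : |ν * (-(12 * Real.pi ^ 2) * Torus.pairing u.1 tgForce)| ≤ 16⁻¹ := by
    have h1 : |Torus.pairing u.1 tgForce| ≤ Real.sqrt E * M := by
      refine (Torus.abs_pairing_coe_le (isSmooth_tgForce.memLp 2) u).trans (mul_le_mul_of_nonneg_right ?_ hM0)
      rw [← Real.sqrt_sq (norm_nonneg u)]
      exact Real.sqrt_le_sqrt hu
    rw [abs_mul, abs_mul, abs_of_pos hν, abs_neg, abs_of_pos (by positivity : (0 : ℝ) < 12 * Real.pi ^ 2),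
      ← mul_assoc]
    have h2 : ν * (12 * Real.pi ^ 2) * (Real.sqrt E * M + 1) ≤ 16⁻¹ := by
      have h3 : ν * (16 * (12 * Real.pi ^ 2) * (Real.sqrt E * M + 1)) ≤ 1 := by
        rw [← le_div_iff₀ (by positivity)]; exact (le_of_lt hνlt).trans (le_of_eq (by ring))
      nlinarith
    calc ν * (12 * Real.pi ^ 2) * |Torus.pairing u.1 tgForce|
        ≤ ν * (12 * Real.pi ^ 2) * (Real.sqrt E * M) := by
          exact mul_le_mul_of_nonneg_left h1 (by positivity)
      _ ≤ ν * (12 * Real.pi ^ 2) * (Real.sqrt E * M + 1) := by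
          exact mul_le_mul_of_nonneg_left (by linarith) (by positivity)
      _ ≤ 16⁻¹ := h2
  have hI' := neg_abs_le (Torus.inertialPairing u.1 tgForce)
  have hP' := neg_abs_le (ν * (-(12 * Real.pi ^ 2) * Torus.pairing u.1 tgForce))
  linarith

/-- **`MirrorFloorTG` at small energy** — the crux VERBATIM with the single extra hypothesis
`E ≤ E₁`: a genuine special case, kernel-checked (the census' BC5 entry). The certificate is the
work functional with `θ₁ = 0`; the mirror-symmetry and finite-enstrophy hypotheses are not used. -/
theorem mirrorFloorTG_smallEnergy :
    ∃ E₁ : ℝ, 0 < E₁ ∧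
    ∀ f : UnitAddTorus (Fin 3) → EuclideanSpace ℝ (Fin 3), f = (fun x => !₂[(fourier 1 (x 0) : ℂ).im * (fourier 1 (x 1) : ℂ).re * (fourier 1 (x 2) : ℂ).re, -((fourier 1 (x 0) : ℂ).re * (fourier 1 (x 1) : ℂ).im * (fourier 1 (x 2) : ℂ).re), (0 : ℝ)]) → ∀ E : ℝ, 0 < E → E ≤ E₁ → ∃ (ε₀ ν₀ : ℝ), 0 < ε₀ ∧ 0 < ν₀ ∧ ∀ ν : ℝ, 0 < ν → ν < ν₀ → ∃ (Φ₁ : Literature.Analysis.FluidPDE.Torus.CylindricalTest (Fin 3)) (θ₁ : ℝ), θ₁ ≤ 0 ∧ ∀ u : Literature.Analysis.FunctionSpaces.Torus.energySpace (Fin 3), let uf : UnitAddTorus (Fin 3) → EuclideanSpace ℝ (Fin 3) := ((u : MeasureTheory.Lp (EuclideanSpace ℝ (Fin 3)) 2 (MeasureTheory.volume : MeasureTheory.Measure (UnitAddTorus (Fin 3)))) : UnitAddTorus (Fin 3) → EuclideanSpace ℝ (Fin 3)); let D : ℝ := ν * (Literature.Analysis.FunctionSpaces.Torus.eGradNormSq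 uf).toReal; let P : ℝ := Literature.Analysis.FluidPDE.Torus.pairing (u : MeasureTheory.Lp (EuclideanSpace ℝ (Fin 3)) 2 (MeasureTheory.volume : MeasureTheory.Measure (UnitAddTorus (Fin 3)))) f - D; (∀ i j : Fin 3, (fun x => uf (Function.update x i (-x i)) j) =ᵐ[MeasureTheory.volume] (fun x => if j = i then -(uf x j) else uf x j)) → Literature.Analysis.FunctionSpaces.Torus.eGradNormSq uf ≠ ⊤ → ‖u‖ ^ 2 ≤ E → ε₀ ≤ D + Literature.Analysis.FluidPDE.Torus.nsGeneratorPairing ν f u (Φ₁.grad u) + 2 * θ₁ * P := by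
  obtain ⟨E₁, hE₁, h⟩ := floor_smallEnergy_uniform
  refine ⟨E₁, hE₁, fun f hf E hE hE1 => ?_⟩
  have hf' : f = tgForce := hf
  subst hf'
  obtain ⟨Φ, ν₀, hν₀, -, hfloor⟩ := h E hE hE1
  refine ⟨8⁻¹, ν₀, by norm_num, hν₀, fun ν hν hνlt => ⟨Φ, 0, le_rfl, fun u _ _ hu => ?_⟩⟩
  have := hfloor ν hν hνlt u hu
  simp only [mul_zero, zero_mul, add_zero]
  exact this

/-! ## §C ANTI-PUMPING (the Marchioro engine transferred to `f_TG`)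

Every relaxed stationary statistic of `NS_ν(f_TG)` — probability measure on `H` carried by a ball, finite
mean enstrophy, cylindrical Liouville identities, integrable work; NO symmetry, NO energy inequality —
satisfies `¼ + ∫ I_{f_TG} dμ ≤ ½ (12π² ν ε(μ))^{1/2}`: statistics of bounded dissipation cancel the force
by Reynolds stress, `∫ I dμ → −¼`. Verbatim instance of the LANDED sibling stub
`TaylorCertificatesFloorCertificate.stub_eigenforceWorkBound` (λ = 12π², `‖f_TG‖² = ¼`). -/

/-- **Anti-pumping for `f_TG`.** -/
theorem antiPumping_tg {ν ρ : ℝ} (hν : 0 < ν) {μ : Measure (Torus.energySpace (Fin 3))} (hP : IsProbabilityMeasure μ)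
    (hball : ∀ᵐ u ∂μ, ‖u‖ ^ 2 ≤ ρ) (hG : Torus.ensembleEnstrophy μ < ⊤)
    (hL : ∀ Φ : Torus.CylindricalTest (Fin 3),
      Integrable (fun u => Torus.nsGeneratorPairing ν tgForce u (Φ.grad u)) μ ∧
        ∫ u, Torus.nsGeneratorPairing ν tgForce u (Φ.grad u) ∂μ = 0)
    (hW : Integrable (fun u : Torus.energySpace (Fin 3) => Torus.pairing u.1 tgForce) μ) :
    4⁻¹ + ∫ u, Torus.inertialPairing u.1 tgForce ∂μ ≤
      2⁻¹ * Real.sqrt (12 * Real.pi ^ 2 * ν * Torus.ensembleDissipation ν μ) := by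
  have h := stub_eigenforceWorkBound ν (12 * Real.pi ^ 2) ρ tgForce hν (by positivity) isSmooth_tgForce
    isDivFree_tgForce hasZeroMean_tgForce laplacian_tgForce_apply μ hP hball hG hL hW
  rw [integral_norm_sq_tgForce] at h
  refine h.trans (le_of_eq ?_)
  rw [Real.sqrt_mul (by norm_num), show (4⁻¹ : ℝ) = 2⁻¹ ^ 2 by norm_num, Real.sqrt_sq (by norm_num)]
  ring_nf


/-! ## §D THE FREE FLOOR IS `O(ν)` (fixed-viscosity loudness of every relaxed statistic of `f_TG`)

From anti-pumping, `|I_{f_TG}(u)| ≤ C_TG |u|²` and Poincaré in the mean (`4π² ∫|u|² dμ ≤ ∫‖∇u‖² dμ`):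
`¼ ≤ C_TG ε(μ)/(4π²ν) + ½ (12π²ν ε(μ))^{1/2}`, whence `ε(μ) ≥ c ν` for `ν ≤ 1/64`, with `c` depending on
`f_TG` only — for EVERY relaxed statistic on EVERY ball, symmetric or not. Census heading TRANSFER (the
fixed-ν sibling of the step is settled; the crux is exactly the upgrade `cν ↦ ε₀(E)`), and NEGATION (no quiet
relaxed statistic exists at any fixed `ν`; every kill must be a `ν → 0` family). -/

/-- **Mean energy is controlled by mean enstrophy** (Poincaré integrated): for a finite measure with finite
mean enstrophy, `4π² ∫ |u|² dμ ≤ (∫⁻ ‖∇u‖² dμ).toReal`. [folklore] -/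
theorem integral_norm_sq_le_ensembleEnstrophy (μ : Measure (Torus.energySpace (Fin 3))) [IsFiniteMeasure μ]
    (hG : Torus.ensembleEnstrophy μ < ⊤) :
    4 * Real.pi ^ 2 * ∫ u, ‖u‖ ^ 2 ∂μ ≤ (Torus.ensembleEnstrophy μ).toReal := by
  have hmeas := (Torus.measurable_eGradNormSq_coe (d := Fin 3))
  have hint : Integrable (fun v : Torus.energySpace (Fin 3) => (Torus.eGradNormSq (v.1 : UnitAddTorus (Fin 3) → EuclideanSpace ℝ (Fin 3))).toReal) μ :=
    integrable_toReal_of_lintegral_ne_top hmeas.aemeasurable hG.ne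
  rw [← integral_const_mul, Torus.ensembleEnstrophy,
    ← integral_toReal hmeas.aemeasurable (ae_lt_top hmeas hG.ne)]
  refine integral_mono_ae ((integrable_norm_sq_of_ensembleEnstrophy_lt_top μ hG).const_mul _) hint ?_
  filter_upwards [ae_lt_top hmeas hG.ne] with v hv
  exact Torus.norm_sq_le_toReal_eGradNormSq v hv.ne

/-- **The implicit fixed-viscosity floor.** For every relaxed statistic of `NS_ν(f_TG)` (no symmetry, no
energy inequality): `¼ ≤ C_TG ε(μ)/(4π²ν) + ½ (12π²ν ε(μ))^{1/2}`. -/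
theorem quarter_le_of_relaxed :
    ∃ C : ℝ, 0 ≤ C ∧ ∀ (ν ρ : ℝ) (μ : Measure (Torus.energySpace (Fin 3))), 0 < ν → IsProbabilityMeasure μ →
      (∀ᵐ u ∂μ, ‖u‖ ^ 2 ≤ ρ) → Torus.ensembleEnstrophy μ < ⊤ →
      (∀ Φ : Torus.CylindricalTest (Fin 3),
        Integrable (fun u => Torus.nsGeneratorPairing ν tgForce u (Φ.grad u)) μ ∧
          ∫ u, Torus.nsGeneratorPairing ν tgForce u (Φ.grad u) ∂μ = 0) →
      Integrable (fun u : Torus.energySpace (Fin 3) => Torus.pairing u.1 tgForce) μ →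
      4⁻¹ ≤ C * (Torus.ensembleDissipation ν μ / (4 * Real.pi ^ 2 * ν)) +
        2⁻¹ * Real.sqrt (12 * Real.pi ^ 2 * ν * Torus.ensembleDissipation ν μ) := by
  obtain ⟨C, hC0, hC⟩ := exists_abs_inertialPairing_tg_le
  refine ⟨C, hC0, fun ν ρ μ hν hP hball hG hL hW => ?_⟩
  have hA := antiPumping_tg hν hP hball hG hL hW
  -- `∫ I dμ ≥ -C ∫ |u|² dμ ≥ -C ε/(4π²ν)`
  have hIint : Integrable (fun u : Torus.energySpace (Fin 3) => Torus.inertialPairing u.1 tgForce) μ := by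
    refine Integrable.mono' ((integrable_norm_sq_of_ensembleEnstrophy_lt_top μ hG).const_mul C)
      (Torus.continuous_inertialPairing_coe isSmooth_tgForce).aestronglyMeasurable ?_
    exact ae_of_all _ fun u => by rw [Real.norm_eq_abs]; exact hC u
  have hI : -(C * ∫ u, ‖u‖ ^ 2 ∂μ) ≤ ∫ u, Torus.inertialPairing u.1 tgForce ∂μ := by
    rw [← integral_const_mul, ← integral_neg]
    refine integral_mono ((integrable_norm_sq_of_ensembleEnstrophy_lt_top μ hG).const_mul C).neg hIint
      fun u => ?_
    have := neg_abs_le (Torus.inertialPairing u.1 tgForce)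
    dsimp only
    linarith [hC u]
  have hE := integral_norm_sq_le_ensembleEnstrophy μ hG
  have hE' : C * ∫ u, ‖u‖ ^ 2 ∂μ ≤ C * (Torus.ensembleDissipation ν μ / (4 * Real.pi ^ 2 * ν)) := by
    refine mul_le_mul_of_nonneg_left ?_ hC0
    rw [Torus.ensembleDissipation, le_div_iff₀ (by positivity)]
    nlinarith
  linarith

/-- **THE FREE FLOOR IS `O(ν)`.** There is `c > 0` (depending on `f_TG` only) such that for every
`0 < ν ≤ 1/64` every relaxed statistic of `NS_ν(f_TG)` on any ball — probability, finite mean enstrophy,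
cylindrical Liouville identities, integrable work; no symmetry, no energy inequality — dissipates at least
`c ν`. The crux asks for `ε₀(E)` in place of `c ν`: its entire open content is the uniformity in `ν`. -/
theorem fixedViscosity_floor :
    ∃ c : ℝ, 0 < c ∧ ∀ (ν ρ : ℝ) (μ : Measure (Torus.energySpace (Fin 3))), 0 < ν → ν ≤ 64⁻¹ → IsProbabilityMeasure μ →
      (∀ᵐ u ∂μ, ‖u‖ ^ 2 ≤ ρ) → Torus.ensembleEnstrophy μ < ⊤ →
      (∀ Φ : Torus.CylindricalTest (Fin 3),
        Integrable (fun u => Torus.nsGeneratorPairing ν tgForce u (Φ.grad u)) μ ∧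
          ∫ u, Torus.nsGeneratorPairing ν tgForce u (Φ.grad u) ∂μ = 0) →
      Integrable (fun u : Torus.energySpace (Fin 3) => Torus.pairing u.1 tgForce) μ →
      c * ν ≤ Torus.ensembleDissipation ν μ := by
  obtain ⟨C, hC0, hC⟩ := quarter_le_of_relaxed
  refine ⟨min 1 (Real.pi ^ 2 / (2 * (C + 1))), lt_min one_pos (by positivity),
    fun ν ρ μ hν hν64 hP hball hG hL hW => ?_⟩
  have h := hC ν ρ μ hν hP hball hG hL hW
  set ε := Torus.ensembleDissipation ν μ with hε
  have hε0 : 0 ≤ ε := by rw [hε, Torus.ensembleDissipation]; positivity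
  by_contra hlt
  rw [not_le] at hlt
  have hεν : ε < ν := hlt.trans_le (by nlinarith [min_le_left (1 : ℝ) (Real.pi ^ 2 / (2 * (C + 1)))])
  -- the square-root term is `≤ 1/8`
  have hsq : 2⁻¹ * Real.sqrt (12 * Real.pi ^ 2 * ν * ε) ≤ 8⁻¹ := by
    have h1 : 12 * Real.pi ^ 2 * ν * ε ≤ (16 * ν) ^ 2 := by
      have hpi : Real.pi ^ 2 ≤ 16 := by nlinarith [Real.pi_lt_four, Real.pi_pos]
      nlinarith [mul_le_mul_of_nonneg_left hεν.le (by positivity : (0 : ℝ) ≤ 12 * Real.pi ^ 2 * ν)]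
    have h2 : Real.sqrt (12 * Real.pi ^ 2 * ν * ε) ≤ 16 * ν := by
      rw [← Real.sqrt_sq (by positivity : (0 : ℝ) ≤ 16 * ν)]
      exact Real.sqrt_le_sqrt h1
    nlinarith
  -- hence the stress term carries `1/8`, forcing `ε ≥ π² ν/(2(C+1))`
  have hC8 : 8⁻¹ ≤ C * (ε / (4 * Real.pi ^ 2 * ν)) := by linarith
  have hεlow : Real.pi ^ 2 / (2 * (C + 1)) * ν ≤ ε := by
    rw [div_mul_eq_mul_div, div_le_iff₀ (by positivity)]
    have h3 : 8⁻¹ * (4 * Real.pi ^ 2 * ν) ≤ C * ε := by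
      rw [← mul_div_assoc] at hC8
      exact (le_div_iff₀ (by positivity)).1 hC8
    nlinarith
  have : min 1 (Real.pi ^ 2 / (2 * (C + 1))) * ν ≤ ε :=
    (mul_le_mul_of_nonneg_right (min_le_right _ _) hν.le).trans hεlow
  linarith

/-! ## §E SMALL ENERGY, DUAL SIDE: the relaxed class is EMPTY (so S3 holds vacuously there)

With the energy inequality `ε(μ) ≤ ∫(u,f_TG) dμ ≤ ½ √ρ` and `|I| ≤ C_TG ρ` on the ball, anti-pumping reads
`¼ ≤ C_TG ρ + ½ (12π²ν · ½√ρ)^{1/2}`: impossible for `ρ ≤ 1/(16(C_TG+1))` and small `ν`. -/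

/-- **No relaxed statistic of small energy.** -/
theorem relaxed_empty_smallEnergy :
    ∃ ρ₁ : ℝ, 0 < ρ₁ ∧ ∀ ρ : ℝ, 0 ≤ ρ → ρ ≤ ρ₁ → ∀ (ν : ℝ) (μ : Measure (Torus.energySpace (Fin 3))), 0 < ν → ν ≤ 64⁻¹ →
      IsProbabilityMeasure μ → (∀ᵐ u ∂μ, ‖u‖ ^ 2 ≤ ρ) → Torus.ensembleEnstrophy μ < ⊤ →
      (∀ Φ : Torus.CylindricalTest (Fin 3),
        Integrable (fun u => Torus.nsGeneratorPairing ν tgForce u (Φ.grad u)) μ ∧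
          ∫ u, Torus.nsGeneratorPairing ν tgForce u (Φ.grad u) ∂μ = 0) →
      Integrable (fun u : Torus.energySpace (Fin 3) => Torus.pairing u.1 tgForce) μ →
      Torus.ensembleDissipation ν μ ≤ ∫ u, Torus.pairing u.1 tgForce ∂μ → False := by
  obtain ⟨C, hC0, hC⟩ := exists_abs_inertialPairing_tg_le
  set M : ℝ := ‖(isSmooth_tgForce.memLp 2).toLp tgForce‖ with hM
  have hM0 : 0 ≤ M := norm_nonneg _
  refine ⟨min (1 / (16 * (C + 1))) ((1 / (256 * (M + 1))) ^ 2), lt_min (by positivity) (by positivity),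
    fun ρ hρ0 hρ1 ν μ hν hν64 hP hball hG hL hW hEI => ?_⟩
  have hA := antiPumping_tg hν hP hball hG hL hW
  -- `∫ I ≥ -C ρ`
  have hIint : Integrable (fun u : Torus.energySpace (Fin 3) => Torus.inertialPairing u.1 tgForce) μ := by
    refine Integrable.mono' (integrable_const (C * ρ))
      (Torus.continuous_inertialPairing_coe isSmooth_tgForce).aestronglyMeasurable ?_
    filter_upwards [hball] with u hu
    rw [Real.norm_eq_abs]
    exact (hC u).trans (mul_le_mul_of_nonneg_left hu hC0)
  have hI : -(C * ρ) ≤ ∫ u, Torus.inertialPairing u.1 tgForce ∂μ := by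
    have h1 : ∫ _ : Torus.energySpace (Fin 3), -(C * ρ) ∂μ ≤ ∫ u, Torus.inertialPairing u.1 tgForce ∂μ := by
      refine integral_mono_ae (integrable_const _) hIint ?_
      filter_upwards [hball] with u hu
      have := neg_abs_le (Torus.inertialPairing u.1 tgForce)
      linarith [(hC u).trans (mul_le_mul_of_nonneg_left hu hC0)]
    simpa using h1
  -- `∫ (u,f) ≤ √ρ M`
  have hWle : ∫ u, Torus.pairing u.1 tgForce ∂μ ≤ Real.sqrt ρ * M := by
    have h1 : ∫ u, Torus.pairing u.1 tgForce ∂μ ≤ ∫ _ : Torus.energySpace (Fin 3), Real.sqrt ρ * M ∂μ := by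
      refine integral_mono_ae hW (integrable_const _) ?_
      filter_upwards [hball] with u hu
      refine (le_abs_self _).trans ((Torus.abs_pairing_coe_le (isSmooth_tgForce.memLp 2) u).trans ?_)
      refine mul_le_mul_of_nonneg_right ?_ hM0
      rw [← Real.sqrt_sq (norm_nonneg u)]
      exact Real.sqrt_le_sqrt hu
    simpa using h1
  have hε := hEI.trans hWle
  -- `√ρ ≤ 1/(16(M+1))` and `ρ ≤ 1/(16(C+1))`
  have hρC : C * ρ ≤ 16⁻¹ := by
    calc C * ρ ≤ (C + 1) * ρ := by nlinarith
      _ ≤ (C + 1) * (1 / (16 * (C + 1))) :=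
          mul_le_mul_of_nonneg_left (hρ1.trans (min_le_left _ _)) (by positivity)
      _ = 16⁻¹ := by field_simp
  have hρM : Real.sqrt ρ * M ≤ 256⁻¹ := by
    have h1 : Real.sqrt ρ ≤ 1 / (256 * (M + 1)) := by
      rw [← Real.sqrt_sq (by positivity : (0 : ℝ) ≤ 1 / (256 * (M + 1)))]
      exact Real.sqrt_le_sqrt (hρ1.trans (min_le_right _ _))
    calc Real.sqrt ρ * M ≤ 1 / (256 * (M + 1)) * M := mul_le_mul_of_nonneg_right h1 hM0
      _ ≤ 1 / (256 * (M + 1)) * (M + 1) := mul_le_mul_of_nonneg_left (by linarith) (by positivity)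
      _ = 256⁻¹ := by field_simp
  -- the square-root term: `12π²ν ε ≤ 12·16·(1/64)·(1/256) ≤ (1/4)²`
  have hsq : 2⁻¹ * Real.sqrt (12 * Real.pi ^ 2 * ν * Torus.ensembleDissipation ν μ) ≤ 8⁻¹ := by
    have hε0 : 0 ≤ Torus.ensembleDissipation ν μ := by rw [Torus.ensembleDissipation]; positivity
    have h1 : 12 * Real.pi ^ 2 * ν * Torus.ensembleDissipation ν μ ≤ (4⁻¹) ^ 2 := by
      have hpi : Real.pi ^ 2 ≤ 16 := by nlinarith [Real.pi_lt_four, Real.pi_pos]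
      have h2 : Torus.ensembleDissipation ν μ ≤ 256⁻¹ := hε.trans hρM
      have a1 : 12 * Real.pi ^ 2 * ν ≤ 12 * 16 * 64⁻¹ := by
        nlinarith [mul_nonneg (sub_nonneg.2 hpi) hν.le]
      have a2 : 12 * Real.pi ^ 2 * ν * Torus.ensembleDissipation ν μ ≤ 12 * 16 * 64⁻¹ * 256⁻¹ :=
        mul_le_mul a1 h2 hε0 (by norm_num)
      exact a2.trans (by norm_num)
    have h2 : Real.sqrt (12 * Real.pi ^ 2 * ν * Torus.ensembleDissipation ν μ) ≤ 4⁻¹ := by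
      rw [← Real.sqrt_sq (by norm_num : (0 : ℝ) ≤ 4⁻¹)]
      exact Real.sqrt_le_sqrt h1
    linarith
  linarith

/-- **S3 (`stub_mirrorLawsLoudTG`) at small energy** — the registered stub's statement VERBATIM with the
single extra hypothesis `E ≤ E₁`: vacuously true (no relaxed K-statistic of energy `≤ E₁` exists). -/
theorem mirrorLawsLoudTG_smallEnergy :
    ∃ E₁ : ℝ, 0 < E₁ ∧
    ∀ f : UnitAddTorus (Fin 3) → EuclideanSpace ℝ (Fin 3),
      f = (fun x => !₂[(fourier 1 (x 0) : ℂ).im * (fourier 1 (x 1) : ℂ).re * (fourier 1 (x 2) : ℂ).re,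
        -((fourier 1 (x 0) : ℂ).re * (fourier 1 (x 1) : ℂ).im * (fourier 1 (x 2) : ℂ).re), (0 : ℝ)]) →
    ∀ E : ℝ, 0 < E → E ≤ E₁ → ∃ ε₀ ν₀ : ℝ, 0 < ε₀ ∧ 0 < ν₀ ∧ ∀ ν : ℝ, 0 < ν → ν < ν₀ →
      ∀ μ : Measure (Torus.energySpace (Fin 3)), IsProbabilityMeasure μ →
        (∀ᵐ u ∂μ, ∀ i j : Fin 3,
          (fun x => (u.1 : UnitAddTorus (Fin 3) → EuclideanSpace ℝ (Fin 3)) (Function.update x i (-x i)) j)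
            =ᵐ[volume]
          (fun x => if j = i then -((u.1 : UnitAddTorus (Fin 3) → EuclideanSpace ℝ (Fin 3)) x j)
            else (u.1 : UnitAddTorus (Fin 3) → EuclideanSpace ℝ (Fin 3)) x j)) →
        (∀ᵐ u ∂μ, ‖u‖ ^ 2 ≤ E) →
        Torus.ensembleEnstrophy μ < ⊤ →
        (∀ Φ : Torus.CylindricalTest (Fin 3),
          Integrable (fun u => Torus.nsGeneratorPairing ν f u (Φ.grad u)) μ ∧
            ∫ u, Torus.nsGeneratorPairing ν f u (Φ.grad u) ∂μ = 0) →
        Integrable (fun u : Torus.energySpace (Fin 3) => Torus.pairing u.1 f) μ →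
        Torus.ensembleDissipation ν μ ≤ ∫ u, Torus.pairing u.1 f ∂μ →
        ε₀ ≤ Torus.ensembleDissipation ν μ := by
  obtain ⟨ρ₁, hρ₁, h⟩ := relaxed_empty_smallEnergy
  refine ⟨ρ₁, hρ₁, fun f hf E hE hE1 => ?_⟩
  have hf' : f = tgForce := hf
  subst hf'
  refine ⟨1, 64⁻¹, one_pos, by norm_num, fun ν hν hνlt μ hP _ hball hG hL hW hEI => ?_⟩
  exact (h E hE.le hE1 ν μ hν hνlt.le hP hball hG hL hW hEI).elim


end Summit.AnomalousDissipation.AnomalousDissipation.Theorems.PumpedMirrorMirrorFloorTG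

end
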